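import Summits.SmoothPoincare4.SmoothPoincare4.Theorems.SullivanDualWitnessChargeHelperMemberGraphMain
import Summits.SmoothPoincare4.SmoothPoincare4.Theorems.SullivanDualWitnessChargeHelperMemberGraphFunction
import Summits.SmoothPoincare4.SmoothPoincare4.Theorems.SullivanDualWitnessChargeHelperEndHolomorphic
import Summits.SmoothPoincare4.SmoothPoincare4.Theorems.SullivanDualWitnessChargeHelperHoloInverse
import Summits.SmoothPoincare4.SmoothPoincare4.Theorems.SullivanDualWitnessChargeHelperSigmaOmitted
import Mathlib.Analysis.Complex.Basic

/-!
# Helper `helper_memberFarCovers` of line `Sketch` for crux `WitnessCharge`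
(item stmt-SmoothPoincare4-7824; route `SullivanDual`, crux
`Summit.SmoothPoincare4.SmoothPoincare4.Theses.SullivanDual.WitnessCharge`; line `Sketch`,
registered stub `helper_memberFarCovers` of the lead's cycle-2 helper skeleton, wave 2 —
(N)-branch uniform control)

**The far part of the parameter plane is covered by the graph region.** Let `J` be STANDARD on the
punctured `ε'`-chart-ball `B_{ε'}` at `p` (closed `ε'`-ball inside the chart target) and let
`u : ℂ → Σ∖p` be a pencil member of intercept `b` (`IsPencilMember J u b`). Write
`φ ξ = (Ycoord p (u ξ)).1` and, for `R > ε'⁻¹`, `G_R = {ξ | u ξ ∈ B_{ε'}, R < ‖φ ξ‖}`. Then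

  `{ξ | 2R < ‖ξ‖} ⊆ G_R`.

Proof.
* `G_R` is open and `φ` is holomorphic on it (`helper_endHolomorphic`, E0), and by the graph
  structure `helper_memberGraph` ((P3)(a)) `φ : G_R → {R < ‖z‖}` is a bijection with zero-free
  derivative; so (`helper_holoInverse`) its inverse `ψ = invFunOn φ G_R` is holomorphic and
  injective on `{R < ‖z‖}` and maps it into `G_R`.
* `ψ z − z → 0` at infinity: `φ ξ − ξ → 0` at infinity (member axiom), and `φ` is bounded on the
  part of `u⁻¹(B_{ε'})` inside every disc (`exists_norm_fst_Ycoord_le_of_norm_le`), so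
  `ψ z → ∞` as `z → ∞` and `ψ z − z = −(φ (ψ z) − ψ z)`.
* By the omitted-value bound for the class `Σ` (`helper_sigmaOmitted`, Pommerenke Thm. 1.5) every
  `ξ ∉ ψ '' {R < ‖z‖}` has `‖ξ‖ ≤ 2R`; since `ψ '' {R < ‖z‖} ⊆ G_R`, contrapositively
  `2R < ‖ξ‖` forces `ξ = ψ z ∈ G_R`.

The argument is split into an abstract one-variable statement (`farCovers_of_bijOn`, for any
`Y : ℂ → ℂ × ℂ` holomorphic on an open `{ξ | P ξ}`) and its instantiation `Y = Ycoord p ∘ u`,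
`P ξ ↔ u ξ ∈ B_{ε'}`.
-/

noncomputable section

-- the registered namespace `Summit.SmoothPoincare4.SmoothPoincare4.…` repeats a component
set_option linter.dupNamespace false

open scoped Manifold ContDiff Topology
open Set Filter Literature.Geometry.Kaehler Literature.Geometry.Symplectic
  Literature.Topology.FourManifolds

namespace Summit.SmoothPoincare4.SmoothPoincare4.Theorems.WitnessCharge.PencilIncompleteness

/-! ### The abstract statement -/

/-- **The inverse of the graph coordinate is normalised at infinity.** Let `Y = (Z, W) : ℂ → ℂ × ℂ`,
let `Z` restrict to a bijection `U_R = {ξ | P ξ ∧ R < ‖Z ξ‖} → {R < ‖z‖}`, let `Z ξ − ξ → 0` at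
infinity, and let `Z` be bounded on the part of `{ξ | P ξ}` inside every disc. Then the inverse
`g = invFunOn Z U_R` satisfies `g z − z → 0` at infinity. -/
theorem farCovers_invFunOn_tendsto (Y : ℂ → ℂ × ℂ) (P : ℂ → Prop) (R : ℝ)
    (hbij : BijOn (fun ξ => (Y ξ).1) {ξ | P ξ ∧ R < ‖(Y ξ).1‖} {z | R < ‖z‖})
    (hlim : Tendsto (fun ξ => (Y ξ).1 - ξ) (cocompact ℂ) (𝓝 0))
    (hconf : ∀ r₀ : ℝ, ∃ C : ℝ, ∀ ξ, P ξ → ‖ξ‖ ≤ r₀ → ‖(Y ξ).1‖ ≤ C) :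
    Tendsto (fun z => Function.invFunOn (fun ξ => (Y ξ).1) {ξ | P ξ ∧ R < ‖(Y ξ).1‖} z - z)
      (cocompact ℂ) (𝓝 0) := by
  classical
  set g : ℂ → ℂ := Function.invFunOn (fun ξ => (Y ξ).1) {ξ | P ξ ∧ R < ‖(Y ξ).1‖}
  have hmaps : MapsTo g {z | R < ‖z‖} {ξ | P ξ ∧ R < ‖(Y ξ).1‖} := hbij.surjOn.mapsTo_invFunOn
  have hright : ∀ z : ℂ, R < ‖z‖ → (Y (g z)).1 = z := fun z hz =>
    hbij.surjOn.rightInvOn_invFunOn hz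
  refine Metric.tendsto_nhds.2 fun δ hδ => ?_
  obtain ⟨K₁, hK₁, hK₁sub⟩ := mem_cocompact.1 (Metric.tendsto_nhds.1 hlim δ hδ)
  obtain ⟨r₀, hr₀⟩ := isBounded_iff_forall_norm_le.1 hK₁.isBounded
  obtain ⟨C, hC⟩ := hconf r₀
  refine mem_cocompact.2 ⟨Metric.closedBall 0 (max R C), isCompact_closedBall 0 (max R C),
    fun z hz => ?_⟩
  have hzM : max R C < ‖z‖ := not_le.1 fun hle => hz (mem_closedBall_zero_iff.2 hle)
  have hzR : R < ‖z‖ := (le_max_left _ _).trans_lt hzM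
  have hzC : C < ‖z‖ := (le_max_right _ _).trans_lt hzM
  have hξ := hmaps hzR
  -- the preimage `g z ∈ U_R` lies outside the disc `‖ξ‖ ≤ r₀`, hence outside `K₁`
  have hr : r₀ < ‖g z‖ := by
    refine not_le.1 fun hle => (hC (g z) hξ.1 hle).not_gt ?_
    rw [hright z hzR]
    exact hzC
  have hnot : g z ∉ K₁ := fun hmem => (hr₀ _ hmem).not_gt hr
  have hd : dist ((Y (g z)).1 - g z) 0 < δ := hK₁sub hnot
  rw [hright z hzR] at hd
  show dist (g z - z) 0 < δ
  rw [dist_zero_right] at hd ⊢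
  rwa [norm_sub_rev]

/-- **Far covering, abstract form.** Let `Y = (Z, W) : ℂ → ℂ × ℂ` be complex differentiable on an
open set `{ξ | P ξ}`, let `Z` restrict to a bijection `U_R = {ξ | P ξ ∧ R < ‖Z ξ‖} → {R < ‖z‖}`
(`R > 0`) with zero-free derivative, let `Z ξ − ξ → 0` at infinity, and let `Z` be bounded on the
part of `{ξ | P ξ}` inside every disc. Then `{ξ | 2R < ‖ξ‖} ⊆ U_R`: the inverse
`g = invFunOn Z U_R` is holomorphic (`helper_holoInverse`) and injective on `{R < ‖z‖}` with
`g z − z → 0` at infinity (`farCovers_invFunOn_tendsto`), so its omitted values have norm `≤ 2R`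
(`helper_sigmaOmitted`), while its values lie in `U_R`. -/
theorem farCovers_of_bijOn (Y : ℂ → ℂ × ℂ) (P : ℂ → Prop) (R : ℝ) (hR : 0 < R)
    (hUopen : IsOpen {ξ | P ξ}) (hdiff : DifferentiableOn ℂ Y {ξ | P ξ})
    (hbij : BijOn (fun ξ => (Y ξ).1) {ξ | P ξ ∧ R < ‖(Y ξ).1‖} {z | R < ‖z‖})
    (hder : ∀ ξ, P ξ → R < ‖(Y ξ).1‖ → deriv (fun ξ => (Y ξ).1) ξ ≠ 0)
    (hlim : Tendsto (fun ξ => (Y ξ).1 - ξ) (cocompact ℂ) (𝓝 0))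
    (hconf : ∀ r₀ : ℝ, ∃ C : ℝ, ∀ ξ, P ξ → ‖ξ‖ ≤ r₀ → ‖(Y ξ).1‖ ≤ C) :
    ∀ ξ : ℂ, 2 * R < ‖ξ‖ → P ξ ∧ R < ‖(Y ξ).1‖ := by
  classical
  set g : ℂ → ℂ := Function.invFunOn (fun ξ => (Y ξ).1) {ξ | P ξ ∧ R < ‖(Y ξ).1‖}
  have hmaps : MapsTo g {z | R < ‖z‖} {ξ | P ξ ∧ R < ‖(Y ξ).1‖} := hbij.surjOn.mapsTo_invFunOn
  have hright : ∀ z : ℂ, R < ‖z‖ → (Y (g z)).1 = z := fun z hz =>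
    hbij.surjOn.rightInvOn_invFunOn hz
  -- `U_R` is open and `Z` is holomorphic on it
  have hURopen : IsOpen {ξ | P ξ ∧ R < ‖(Y ξ).1‖} :=
    hdiff.fst.continuousOn.norm.isOpen_inter_preimage hUopen isOpen_Ioi
  have hsub : {ξ | P ξ ∧ R < ‖(Y ξ).1‖} ⊆ {ξ | P ξ} := fun ξ hξ => hξ.1
  have hZdiff : DifferentiableOn ℂ (fun ξ => (Y ξ).1) {ξ | P ξ ∧ R < ‖(Y ξ).1‖} :=
    hdiff.fst.mono hsub
  -- the inverse is holomorphic on `Z '' U_R = {R < ‖z‖}`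
  have hgdiff : DifferentiableOn ℂ g {z | R < ‖z‖} := by
    obtain ⟨-, h, -⟩ := helper_holoInverse (fun ξ => (Y ξ).1) {ξ | P ξ ∧ R < ‖(Y ξ).1‖} hURopen
      hZdiff hbij.injOn fun ξ hξ => hder ξ hξ.1 hξ.2
    rwa [hbij.image_eq] at h
  -- the inverse is injective on `{R < ‖z‖}` (it has the left inverse `Z` there)
  have hginj : InjOn g {z | R < ‖z‖} := fun z₁ hz₁ z₂ hz₂ h => by
    rw [← hright z₁ hz₁, ← hright z₂ hz₂]
    exact congrArg (fun ξ => (Y ξ).1) h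
  -- and normalised at infinity
  have hglim : Tendsto (fun z => g z - z) (cocompact ℂ) (𝓝 0) :=
    farCovers_invFunOn_tendsto Y P R hbij hlim hconf
  -- omitted values of `g` have norm `≤ 2R`; values of `g` lie in `U_R`
  intro ξ hξ
  by_contra hnot
  refine (helper_sigmaOmitted R hR g hgdiff hginj hglim ξ ?_).not_gt hξ
  rintro ⟨z, hz, rfl⟩
  exact hnot (hmaps hz)

/-! ### The helper -/

/-- **Far covering (registered stub `helper_memberFarCovers`, (N)-branch uniform control).** For
`J` standard on the punctured `ε'`-chart-ball at `p` (closed `ε'`-ball inside the chart target), a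
pencil member `u` of intercept `b` and `R > ε'⁻¹`: every parameter `ξ` with `2R < ‖ξ‖` is mapped
into the punctured `ε'`-chart-ball with first flat coordinate of norm `> R`, i.e.
`{2R < ‖ξ‖} ⊆ G_R = {ξ | u ξ ∈ B_{ε'}, R < ‖(Ycoord p (u ξ)).1‖}`. Proof: the inverse `ψ` of the
graph coordinate `φ = (Ycoord p ∘ u).1 : G_R → {R < ‖z‖}` (`helper_memberGraph`,
`helper_endHolomorphic`, `helper_holoInverse`) is univalent on `{R < ‖z‖}` with `ψ z − z → 0`, so
by the omitted-value bound `helper_sigmaOmitted` everything of norm `> 2R` is a value of `ψ`,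
hence lies in `G_R`. -/
theorem helper_memberFarCovers :
    ∀ (S : HomotopySphere 4) (p : S.carrier)
      (J : ∀ x : punctured p, TangentSpace (𝓡 4) x →L[ℝ] TangentSpace (𝓡 4) x) (ε' : ℝ)
      (u : ℂ → punctured p) (b : ℂ),
      0 < ε' →
      Metric.closedBall (extChartAt (𝓡 4) p p) ε' ⊆ (extChartAt (𝓡 4) p).target →
      (∀ x : punctured p, InPuncturedChartBall p ε' x →
        ∀ (v : TangentSpace (𝓡 4) x) (b : EuclideanSpace ℝ (Fin 4)),
          inner ℝ (fderiv ℝ inversion (extChartAt (𝓡 4) p x.1 - extChartAt (𝓡 4) p p)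
            (mfderiv (𝓡 4) 𝓘(ℝ, EuclideanSpace ℝ (Fin 4))
              (fun z : punctured p => extChartAt (𝓡 4) p z.1) x (J x v))) b
          = stdSymplecticForm (fderiv ℝ inversion (extChartAt (𝓡 4) p x.1 - extChartAt (𝓡 4) p p)
            (mfderiv (𝓡 4) 𝓘(ℝ, EuclideanSpace ℝ (Fin 4))
              (fun z : punctured p => extChartAt (𝓡 4) p z.1) x v)) b) →
      IsPencilMember J u b →
      ∀ R : ℝ, ε'⁻¹ < R → ∀ ξ : ℂ, 2 * R < ‖ξ‖ →
        InPuncturedChartBall p ε' (u ξ) ∧ R < ‖(Ycoord p (u ξ)).1‖ := by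
  intro S p J ε' u b hε' hball hJstd hmem R hR ξ hξ
  obtain ⟨hbij, hder⟩ := helper_memberGraph S p J ε' u b hε' hball hJstd hmem R hR
  obtain ⟨hcurve, -, -, -, hz, -⟩ := hmem
  obtain ⟨hUopen, hdiff, -, -⟩ :=
    helper_endHolomorphic S p J ε' hε' hball hJstd u hcurve.contMDiff hcurve.isJHolomorphic
  exact farCovers_of_bijOn (fun ξ : ℂ => Ycoord p (u ξ))
    (fun ξ : ℂ => InPuncturedChartBall p ε' (u ξ)) R ((inv_pos.2 hε').trans hR) hUopen hdiff hbij
    hder hz (exists_norm_fst_Ycoord_le_of_norm_le ε' hcurve.contMDiff.continuous) ξ hξ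

end Summit.SmoothPoincare4.SmoothPoincare4.Theorems.WitnessCharge.PencilIncompleteness
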